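import Mathlib
import Literature.Probability.LatticeModels.ConformalCovariance
import Summits.CriticalPhenomena.Ising3DConformalLimit.Theses.PositivityBegetsConformality
import Summits.CriticalPhenomena.Ising3DConformalLimit.Theorems.PrecisionLaplacianMoebiusLimitOfTwoPointLawInversionBegetsRotations
import HarnessLib

/-!
# Inversion positivity implies inversion covariance: `PositivityImpliesInversionCovariance`

(Item stmt-CriticalPhenomena-4674, the support lemma "the Lemma (card P0)" of route
`PositivityBegetsConformality` for the sub-problem `Ising3DConformalLimit`; proved by name as
`positivityImpliesInversionCovariance_proof`.)

Let `S : CorrFamily 3` vanish off `NonCoincident`, be permutation symmetric, scale covariant with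
dimension `Δ`, and *inversion positive with weight `Δ`*: for every finite family `X a` of injective
configurations in the punctured open unit ball (arities `k a`, possibly `0`) the radial
Osterwalder–Schrader Gram matrix
`M a b = (∏ i, ‖X b i‖ ^ (-2Δ)) * S (k a + k b) (X a ⊔ ι ∘ X b)`, `ι y = y / ‖y‖²`, is
`Matrix.PosSemidef`. Then `S` is inversion covariant with dimension `Δ`
(`IsInversionCovariant Δ S`: `S n (ι ∘ x) = (∏ i, ‖x i‖ ^ (2Δ)) * S n x` whenever all `x i ≠ 0`).

Proof (two pages of linear algebra, every `Δ : ℝ`).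
* `Matrix.PosSemidef` includes `IsHermitian`, so the Gram matrix of the TWO-member family
  `(X₀, X₁)` is symmetric: `w(X₁) S (X₀ ⊔ ι X₁) = w(X₀) S (X₁ ⊔ ι X₀)` (`gram_offDiag_symm`; the only
  place the positivity hypothesis is used).
* A configuration `y` avoiding `0` AND the unit sphere splits along any bijection
  `Fin p ⊕ Fin q ≃ Fin n` sorting its points into inside/outside the ball; with `X₀ = y|inside` and
  `X₁ = ι ∘ y|outside` (inside the punctured ball since `‖ι z‖ = ‖z‖⁻¹`) the symmetry reads, after
  a permutation of `Fin n` and `ι ∘ ι = id`, `S n (ι ∘ y) = (∏ ‖y i‖ ^ (2Δ)) S n y`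
  (`inversion_covariant_of_split`).
* Points ON the unit sphere are removed by a dilation `y = c • x` with `c > 0` off the finite set
  `{‖x i‖⁻¹}`; scale covariance transports the identity back (`ι (c • z) = c⁻¹ • ι z`, the weights
  `c ^ (± n Δ)` cancel) (`inversion_covariant_of_smul`).
* Non-injective `x`: `ι` is injective, so both sides vanish by the normalisation off
  `NonCoincident`.

References: the symmetry half of reflection (Osterwalder–Schrader) positivity is folklore,
J. Glimm, A. Jaffe, *Quantum Physics* (Springer 1987) §6.1; K. Osterwalder, R. Schrader,
Comm. Math. Phys. 31 (1973); the sphere / radial-quantisation version is G. Mack, in LNP 37 (1975)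
(converse direction); the unit inversion and its conformal weight: P. Di Francesco, P. Mathieu,
D. Sénéchal, *Conformal Field Theory* (Springer 1997) §4.1. Nothing here is specific to the Ising
model; no continuity and no sign of `Δ` is used.
-/

noncomputable section

open Literature.Probability.LatticeModels EuclideanGeometry
open Summit.CriticalPhenomena.Ising3DConformalLimit.PrecisionLaplacianMoebiusLimitOfTwoPointLaw
  (inversion_zero_one_eq_smul norm_inversion_zero_one)

namespace Summit.CriticalPhenomena.Ising3DConformalLimit.Theorems

/-! ### Bookkeeping: permutations, reindexing, the unit inversion -/

/-- A permutation-symmetric correlation family is invariant under reindexing along ANY bijection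
`Fin m ≃ Fin n` (which forces `m = n`). [folklore] -/
theorem corrFamily_comp_equiv {S : CorrFamily 3}
    (hperm : ∀ (n : ℕ) (σ : Equiv.Perm (Fin n)) (z : Fin n → EuclideanSpace ℝ (Fin 3)),
      S n (fun i => z (σ i)) = S n z)
    {m n : ℕ} (e : Fin m ≃ Fin n) (z : Fin n → EuclideanSpace ℝ (Fin 3)) :
    S m (fun i => z (e i)) = S n z := by
  obtain rfl : m = n := by simpa using Fintype.card_congr e
  exact hperm _ e z

/-- The unit inversion commutes with dilations up to inverting the factor:
`ι (c • z) = c⁻¹ • ι z` for `c ≠ 0`, `z ≠ 0`. (Di Francesco–Mathieu–Sénéchal 1997, §4.1.)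
[folklore] -/
theorem inversion_zero_one_smul {c : ℝ} (hc : c ≠ 0) {z : EuclideanSpace ℝ (Fin 3)} (hz : z ≠ 0) :
    inversion 0 1 (c • z) = c⁻¹ • inversion 0 1 z := by
  have hz' : ‖z‖ ≠ 0 := norm_ne_zero_iff.mpr hz
  rw [inversion_zero_one_eq_smul, inversion_zero_one_eq_smul, norm_smul, Real.norm_eq_abs, smul_smul,
    smul_smul, mul_pow, sq_abs]
  congr 1
  field_simp

/-- `(‖ι z‖) ^ (-s) = ‖z‖ ^ s` for the unit inversion `ι`. [folklore] -/
theorem norm_inversion_rpow_neg (z : EuclideanSpace ℝ (Fin 3)) (s : ℝ) :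
    ‖inversion 0 1 z‖ ^ (-s) = ‖z‖ ^ s := by
  rw [norm_inversion_zero_one, Real.inv_rpow (norm_nonneg _), Real.rpow_neg (norm_nonneg _), inv_inv]

/-! ### The symmetry half of inversion positivity -/

/-- SYMMETRY OF THE RADIAL GRAM MATRIX. If all radial Osterwalder–Schrader Gram matrices of `S`
are positive semi-definite (hence Hermitian, `Matrix.PosSemidef.1`), then for any two injective
configurations `X₀` (arity `p`) and `X₁` (arity `q`) in the punctured open unit ball the
off-diagonal entries of the Gram matrix of the two-member family `(X₀, X₁)` agree:
`(∏ ‖X₁ i‖^(-2Δ)) S (X₀ ⊔ ι X₁) = (∏ ‖X₀ i‖^(-2Δ)) S (X₁ ⊔ ι X₀)`.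
(Glimm–Jaffe 1987 §6.1: a positive form is Hermitian.) [folklore] -/
theorem gram_offDiag_symm {Δ : ℝ} {S : CorrFamily 3}
    (hpos : ∀ (m : ℕ) (k : Fin m → ℕ) (X : (a : Fin m) → Fin (k a) → EuclideanSpace ℝ (Fin 3)),
      (∀ a i, X a i ≠ 0 ∧ ‖X a i‖ < 1) → (∀ a, Function.Injective (X a)) →
      (Matrix.of fun a b : Fin m => (∏ i, ‖X b i‖ ^ (-(2 * Δ))) *
        S (k a + k b) (Fin.append (X a) (fun i => inversion 0 1 (X b i)))).PosSemidef)
    {p q : ℕ} (X₀ : Fin p → EuclideanSpace ℝ (Fin 3)) (X₁ : Fin q → EuclideanSpace ℝ (Fin 3))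
    (h₀ : ∀ i, X₀ i ≠ 0 ∧ ‖X₀ i‖ < 1) (h₁ : ∀ i, X₁ i ≠ 0 ∧ ‖X₁ i‖ < 1)
    (hi₀ : Function.Injective X₀) (hi₁ : Function.Injective X₁) :
    (∏ i, ‖X₁ i‖ ^ (-(2 * Δ))) * S (p + q) (Fin.append X₀ (fun i => inversion 0 1 (X₁ i))) =
      (∏ i, ‖X₀ i‖ ^ (-(2 * Δ))) * S (q + p) (Fin.append X₁ (fun i => inversion 0 1 (X₀ i))) := by
  have key := (hpos 2 ![p, q] (fun a => match a with
      | 0 => X₀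
      | 1 => X₁) (Fin.forall_fin_two.2 ⟨h₀, h₁⟩) (Fin.forall_fin_two.2 ⟨hi₀, hi₁⟩)).1.apply 1 0
  simp only [Matrix.of_apply, star_trivial] at key
  exact key

/-! ### Configurations avoiding the unit sphere -/

/-- INVERSION COVARIANCE OFF THE UNIT SPHERE. Let `S` be permutation symmetric and inversion
positive with weight `Δ`, and let the configuration `y : Fin n → ℝ³` avoid the origin and be
injective, with a bijection `e : Fin p ⊕ Fin q ≃ Fin n` sorting its points into the open unit ball
(`inl`) and its exterior (`inr`). Then `S n (ι ∘ y) = (∏ ‖y i‖ ^ (2Δ)) S n y`: the symmetry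
`gram_offDiag_symm` for `X₀ = y ∘ e ∘ inl`, `X₁ = ι ∘ y ∘ e ∘ inr`, read through the permutation
`e` and `ι ∘ ι = id`. (Mack 1975, converse direction; Glimm–Jaffe 1987 §6.1.) [folklore] -/
theorem inversion_covariant_of_split {Δ : ℝ} {S : CorrFamily 3}
    (hperm : ∀ (n : ℕ) (σ : Equiv.Perm (Fin n)) (z : Fin n → EuclideanSpace ℝ (Fin 3)),
      S n (fun i => z (σ i)) = S n z)
    (hpos : ∀ (m : ℕ) (k : Fin m → ℕ) (X : (a : Fin m) → Fin (k a) → EuclideanSpace ℝ (Fin 3)),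
      (∀ a i, X a i ≠ 0 ∧ ‖X a i‖ < 1) → (∀ a, Function.Injective (X a)) →
      (Matrix.of fun a b : Fin m => (∏ i, ‖X b i‖ ^ (-(2 * Δ))) *
        S (k a + k b) (Fin.append (X a) (fun i => inversion 0 1 (X b i)))).PosSemidef)
    {n p q : ℕ} (y : Fin n → EuclideanSpace ℝ (Fin 3)) (e : Fin p ⊕ Fin q ≃ Fin n)
    (hin : ∀ i, ‖y (e (Sum.inl i))‖ < 1) (hout : ∀ j, 1 < ‖y (e (Sum.inr j))‖)
    (hy0 : ∀ i, y i ≠ 0) (hyinj : Function.Injective y) :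
    S n (fun i => inversion 0 1 (y i)) = (∏ i, ‖y i‖ ^ (2 * Δ)) * S n y := by
  -- the two members of the family
  set X₀ : Fin p → EuclideanSpace ℝ (Fin 3) := fun i => y (e (Sum.inl i)) with hX₀
  set X₁ : Fin q → EuclideanSpace ℝ (Fin 3) := fun j => inversion 0 1 (y (e (Sum.inr j))) with hX₁
  have h₀ : ∀ i, X₀ i ≠ 0 ∧ ‖X₀ i‖ < 1 := fun i => ⟨hy0 _, hin i⟩
  have h₁ : ∀ j, X₁ j ≠ 0 ∧ ‖X₁ j‖ < 1 := by
    intro j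
    refine ⟨?_, ?_⟩
    · simp only [hX₁, Ne, inversion_eq_center one_ne_zero]
      exact hy0 _
    · simp only [hX₁, norm_inversion_zero_one]
      exact inv_lt_one_of_one_lt₀ (hout j)
  have hi₀ : Function.Injective X₀ := fun i j hij => by
    simpa using hyinj hij
  have hi₁ : Function.Injective X₁ := fun i j hij => by
    simpa using hyinj (inversion_injective _ one_ne_zero hij)
  have hsym := gram_offDiag_symm hpos X₀ X₁ h₀ h₁ hi₀ hi₁
  -- reindexing: the two glued configurations are permutations of `y` and of `ι ∘ y`
  have hleft : Fin.append X₀ (fun i => inversion 0 1 (X₁ i)) =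
      fun l => y ((finSumFinEquiv.symm.trans e) l) := by
    funext l
    refine Fin.addCases (fun i => ?_) (fun j => ?_) l
    · simp [hX₀]
    · simp [hX₁, inversion_inversion _ one_ne_zero]
  have hright : Fin.append X₁ (fun i => inversion 0 1 (X₀ i)) =
      fun l => inversion 0 1 (y ((finSumFinEquiv.symm.trans ((Equiv.sumComm _ _).trans e)) l)) := by
    funext l
    refine Fin.addCases (fun i => ?_) (fun j => ?_) l
    · simp [hX₁]
    · simp [hX₀]
  have hSleft : S (p + q) (Fin.append X₀ (fun i => inversion 0 1 (X₁ i))) = S n y := by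
    rw [hleft]
    exact corrFamily_comp_equiv hperm _ y
  have hSright : S (q + p) (Fin.append X₁ (fun i => inversion 0 1 (X₀ i))) =
      S n (fun i => inversion 0 1 (y i)) := by
    rw [hright]
    exact corrFamily_comp_equiv hperm _ (fun i => inversion 0 1 (y i))
  rw [hSleft, hSright] at hsym
  -- the weights
  have hw₁ : (∏ i, ‖X₁ i‖ ^ (-(2 * Δ))) = ∏ j, ‖y (e (Sum.inr j))‖ ^ (2 * Δ) := by
    refine Finset.prod_congr rfl fun j _ => ?_
    simp only [hX₁, norm_inversion_rpow_neg]
  have hw₀ : (∏ i, ‖X₀ i‖ ^ (-(2 * Δ))) = (∏ i, ‖y (e (Sum.inl i))‖ ^ (2 * Δ))⁻¹ := by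
    rw [← Finset.prod_inv_distrib]
    refine Finset.prod_congr rfl fun i _ => ?_
    simp only [hX₀, Real.rpow_neg (norm_nonneg _)]
  have hA : (∏ i, ‖y (e (Sum.inl i))‖ ^ (2 * Δ)) ≠ 0 := by
    refine Finset.prod_ne_zero_iff.mpr fun i _ => ?_
    exact (Real.rpow_pos_of_pos (norm_pos_iff.mpr (hy0 _)) _).ne'
  have hprod : (∏ i, ‖y i‖ ^ (2 * Δ)) =
      (∏ i, ‖y (e (Sum.inl i))‖ ^ (2 * Δ)) * ∏ j, ‖y (e (Sum.inr j))‖ ^ (2 * Δ) := by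
    rw [← Equiv.prod_comp e (fun i => ‖y i‖ ^ (2 * Δ)), Fintype.prod_sum_type]
  rw [hw₁, hw₀] at hsym
  rw [hprod, mul_assoc, hsym, ← mul_assoc, mul_inv_cancel₀ hA, one_mul]

/-! ### Removing the unit sphere by a dilation -/

/-- SCALE COVARIANCE MOVES THE SPHERE. If `S` is scale covariant with dimension `Δ` and the
inversion identity holds at the dilated configuration `c • x` (`c > 0`, all `x i ≠ 0`), then it
holds at `x`: `ι (c • z) = c⁻¹ • ι z` and the weights `c ^ (± n Δ)` cancel. This is the
`ι = D_{1/r²} ∘ ι_r` bookkeeping for the sphere of radius `r = 1/c`.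
(Di Francesco–Mathieu–Sénéchal 1997, §4.1.) [folklore] -/
theorem inversion_covariant_of_smul {Δ : ℝ} {S : CorrFamily 3} (hsc : IsScaleCovariant Δ S)
    {n : ℕ} (x : Fin n → EuclideanSpace ℝ (Fin 3)) (hx : ∀ i, x i ≠ 0) {c : ℝ} (hc : 0 < c)
    (h : S n (fun i => inversion 0 1 (c • x i)) =
      (∏ i, ‖c • x i‖ ^ (2 * Δ)) * S n (fun i => c • x i)) :
    S n (fun i => inversion 0 1 (x i)) = (∏ i, ‖x i‖ ^ (2 * Δ)) * S n x := by
  have hc0 : c ≠ 0 := hc.ne'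
  have hι : (fun i => inversion 0 1 (c • x i)) = fun i => c⁻¹ • inversion 0 1 (x i) := by
    funext i
    exact inversion_zero_one_smul hc0 (hx i)
  have hnorm : (∏ i, ‖c • x i‖ ^ (2 * Δ)) = (c ^ (2 * Δ)) ^ n * ∏ i, ‖x i‖ ^ (2 * Δ) := by
    simp only [norm_smul, Real.norm_of_nonneg hc.le, Real.mul_rpow hc.le (norm_nonneg _),
      Finset.prod_mul_distrib, Finset.prod_const, Finset.card_univ, Fintype.card_fin]
  rw [hι, hsc n c⁻¹ (inv_pos.mpr hc), hnorm, hsc n c hc] at h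
  -- `h : (c⁻¹) ^ (-n Δ) * S(ι x) = (c ^ (2Δ)) ^ n * W * (c ^ (-n Δ) * S x)`
  have ht : (0 : ℝ) < c ^ ((n : ℝ) * Δ) := Real.rpow_pos_of_pos hc _
  have h1 : (c⁻¹) ^ (-(n : ℝ) * Δ) = c ^ ((n : ℝ) * Δ) := by
    rw [Real.inv_rpow hc.le, neg_mul, Real.rpow_neg hc.le, inv_inv]
  have h2 : (c ^ (2 * Δ)) ^ n * c ^ (-(n : ℝ) * Δ) = c ^ ((n : ℝ) * Δ) := by
    rw [← Real.rpow_mul_natCast hc.le, ← Real.rpow_add hc]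
    congr 1
    ring
  rw [h1] at h
  refine mul_left_cancel₀ ht.ne' ?_
  rw [h]
  calc (c ^ (2 * Δ)) ^ n * (∏ i, ‖x i‖ ^ (2 * Δ)) * (c ^ (-(n : ℝ) * Δ) * S n x)
        = ((c ^ (2 * Δ)) ^ n * c ^ (-(n : ℝ) * Δ)) * ((∏ i, ‖x i‖ ^ (2 * Δ)) * S n x) := by ring
    _ = c ^ ((n : ℝ) * Δ) * ((∏ i, ‖x i‖ ^ (2 * Δ)) * S n x) := by rw [h2]

/-! ### The item -/

/-- **Positivity implies inversion covariance** (item stmt-CriticalPhenomena-4674, route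
`PositivityBegetsConformality`, by name). For every `Δ : ℝ` and every correlation family
`S : CorrFamily 3` which vanishes off `NonCoincident`, is permutation symmetric, scale covariant with
dimension `Δ` and inversion positive with weight `Δ` (all radial Osterwalder–Schrader Gram matrices
over finite families of injective configurations in the punctured open unit ball, all arities, are
`Matrix.PosSemidef`), `S` is inversion covariant with dimension `Δ`. Only the HERMITIAN half of
positive semi-definiteness is used. (Glimm–Jaffe 1987 §6.1; Osterwalder–Schrader 1973; Mack 1975;
Di Francesco–Mathieu–Sénéchal 1997 §4.1.) [folklore] -/
theorem positivityImpliesInversionCovariance_proof :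
    Summit.CriticalPhenomena.Ising3DConformalLimit.Theses.PositivityBegetsConformality.PositivityImpliesInversionCovariance := by
  intro Δ S hvan hperm hsc hpos n x hx
  by_cases hinj : Function.Injective x
  swap
  · -- coincident configurations: both sides vanish
    have hx0 : S n x = 0 := hvan n x hinj
    have hι : S n (fun i => inversion 0 1 (x i)) = 0 := by
      refine hvan n _ fun h => hinj fun i j hij => h ?_
      simp only [hij]
    rw [hx0, hι, mul_zero]
  -- a dilation factor `c > 0` putting no point on the unit sphere
  obtain ⟨c, hc, hcn⟩ :=
    (Set.Ioi_infinite (0 : ℝ)).exists_notMem_finset (Finset.univ.image fun i => ‖x i‖⁻¹)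
  have hc : 0 < c := hc
  have hc1 : ∀ i, ‖c • x i‖ ≠ 1 := by
    intro i h
    refine hcn (Finset.mem_image.mpr ⟨i, Finset.mem_univ _, ?_⟩)
    rw [norm_smul, Real.norm_of_nonneg hc.le] at h
    exact (eq_inv_of_mul_eq_one_left h).symm
  refine inversion_covariant_of_smul hsc x hx hc ?_
  -- the dilated configuration avoids `0` and the unit sphere: split it by the unit ball
  set y : Fin n → EuclideanSpace ℝ (Fin 3) := fun i => c • x i with hy
  have hy0 : ∀ i, y i ≠ 0 := fun i => smul_ne_zero hc.ne' (hx i)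
  have hyinj : Function.Injective y := fun i j hij => hinj (smul_right_injective _ hc.ne' hij)
  let eI := (Fintype.equivFin {i // ‖y i‖ < 1}).symm
  let eJ := (Fintype.equivFin {i // ¬ ‖y i‖ < 1}).symm
  let e : Fin (Fintype.card {i // ‖y i‖ < 1}) ⊕ Fin (Fintype.card {i // ¬ ‖y i‖ < 1}) ≃ Fin n :=
    (eI.sumCongr eJ).trans (Equiv.sumCompl fun i => ‖y i‖ < 1)
  refine inversion_covariant_of_split hperm hpos y e (fun i => ?_) (fun j => ?_) hy0 hyinj
  · have := (eI i).2
    simpa [e] using this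
  · have h2 : ¬ ‖y (e (Sum.inr j))‖ < 1 := by
      have := (eJ j).2
      simpa [e] using this
    exact lt_of_le_of_ne (not_lt.mp h2) (Ne.symm (hc1 _))

end Summit.CriticalPhenomena.Ising3DConformalLimit.Theorems

end
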